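import Literature.InformationTheory.QuantumCodes.ToricLayout
import Literature.InformationTheory.QuantumCodes.TwoBlockTannerGraph
import HarnessLib

/-!
# Toric layout of two-block (bivariate-bicycle) codes — Bravyi et al. Lemma 4

Bravyi–Cross–Gambetta–Maslov–Rall–Yoder [BravyiEtAl2024, §5, Lemma 4]: "A code `QC(A,B)` has a toric
layout if there exist `i,j,g,h ∈ {1,2,3}` such that (i) `⟨A_iA_jᵀ, B_gB_hᵀ⟩ = M` and
(ii) `ord(A_iA_jᵀ) ord(B_gB_hᵀ) = ℓm`."  Proof (printed): with `μ = ord(A_iA_jᵀ)`, `λ = ord(B_gB_hᵀ)`,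
the `L` qubit `α = (A_iA_jᵀ)^a (B_gB_hᵀ)^b` goes to `(2a, 2b) ∈ ℤ_{2μ} × ℤ_{2λ}`, the `R` qubit
`αA_jᵀB_g` to `(2a+1, 2b+1)`, the `X`-check `αA_jᵀ` to `(2a+1, 2b)`, the `Z`-check `αB_g` to
`(2a, 2b+1)`; "Edges in the Tanner graph `A_i, A_jᵀ, B_g, B_hᵀ` … correspond to edges in the Cayley
graph".

PROVED here for every abelian two-block code `AbelianTwoBlock.css a b` (any finite abelian `G`;
`QC(A,B)` is `G = ℤ_ℓ × ℤ_m`), in the tree's additive conventions (`TwoBlockTannerGraph.lean`: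
`X i — L j ↔ a(i−j) ≠ 0`, …): for `s, s' ∈ supp a`, `t, t' ∈ supp b` with `α = s − s'`, `β = t − t'`,
`AddSubgroup.closure {α, β} = ⊤` and `addOrderOf α · addOrderOf β = |G|` give
`HasToricLayoutWith (addOrderOf α) (addOrderOf β) (css a b).tannerGraph`
(`hasToricLayoutWith_of_generators`; the placement is `layoutVertex`/`layoutMap`:
`(even,even) ↦ L g`, `(odd,even) ↦ X (g+s)`, `(even,odd) ↦ Z (g−t')`, `(odd,odd) ↦ R (g+s−t')` over
`g = ⌊c/2⌋•α + ⌊d/2⌋•β`), hence `HasToricLayout` (`hasToricLayout_of_generators`); and the bivariate-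
bicycle phrasing with polynomial exponents (`BB.Code.hasToricLayoutWith_of_exponents`), used by the
instances of [BravyiEtAl2024, Table 3] ("All codes in Table have a toric layout with `μ = m` and
`λ = ℓ`") Summits-side.

Definition 1, the torus graph and the generic parametrisation are `ToricLayout.lean`.

## References (locators read on the page)
* [BravyiEtAl2024] Nature 627 (2024) 778 = arXiv:2308.07915, §5 Lemma 4 with proof and the paragraph
  after it (held text paper:arxiv-2308.07915 chunk p0011 L28–39).

No named facts, no instances, no notation.
-/

namespace Literature.InformationTheory.QuantumCodes

open SimpleGraph

/-! ### Lemma 4: the layout -/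

namespace AbelianTwoBlock

variable {G : Type*} [Fintype G] [AddCommGroup G]

/-- The vertex placed over group element `g` at parities `(ε, δ)`: `(even, even) ↦ L g`,
`(odd, even) ↦ X (g + s)`, `(even, odd) ↦ Z (g − t')`, `(odd, odd) ↦ R (g + s − t')` — the tree's
additive rendering of "`L` qubit `α ↦ (2a,2b)`, `R` qubit `αA_jᵀB_g ↦ (2a+1,2b+1)`, `X`-check
`αA_jᵀ ↦ (2a+1,2b)`, `Z`-check `αB_g ↦ (2a,2b+1)`".
[cite: BravyiEtAl2024, proof of Lemma 4 (arXiv:2308.07915 chunk p0011 L32–34)] -/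
def layoutVertex (s t' : G) : Bool → Bool → G → (G ⊕ G) ⊕ (G ⊕ G)
  | false, false, g => vL g
  | true, false, g => vX (g + s)
  | false, true, g => vZ (g - t')
  | true, true, g => vR (g + s - t')

omit [Fintype G] in
/-- `layoutVertex` is injective in `(ε, δ, g)`. [cite: BravyiEtAl2024, proof of Lemma 4 (arXiv:2308.07915 chunk p0011 L31–34)] -/
theorem layoutVertex_injective (s t' : G) {ε δ ε' δ' : Bool} {g g' : G}
    (h : layoutVertex s t' ε δ g = layoutVertex s t' ε' δ' g') : ε = ε' ∧ δ = δ' ∧ g = g' := by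
  cases ε <;> cases δ <;> cases ε' <;> cases δ' <;>
    simp_all [layoutVertex, vL, vX, vZ, vR]

variable {a b : G → ZMod 2} {s s' t t' : G}

/-- **The layout map of Lemma 4**: `(c, d) ∈ ℤ_{2μ} × ℤ_{2ν} ↦` the vertex at parities
`(c mod 2, d mod 2)` over the group element `⌊c/2⌋•α + ⌊d/2⌋•β`.
[cite: BravyiEtAl2024, proof of Lemma 4 (arXiv:2308.07915 chunk p0011 L30–36)] -/
noncomputable def layoutMap (s s' t t' : G) (x : ZMod (2 * addOrderOf (s - s')) × ZMod (2 * addOrderOf (t - t'))) :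
    (G ⊕ G) ⊕ (G ⊕ G) :=
  layoutVertex s t' (par x.1) (par x.2) (torusHom (s - s') (t - t') (half x.1, half x.2))

section Layout

variable (hs : a s ≠ 0) (hs' : a s' ≠ 0) (ht : b t ≠ 0) (ht' : b t' ≠ 0)
include hs hs' ht ht'

omit ht ht' in
/-- Horizontal torus edges `(c,d) — (c+1,d)` go to Tanner-graph edges (edges "`A_i`", "`A_jᵀ`").
[cite: BravyiEtAl2024, proof of Lemma 4 "Edges in the Tanner graph A_i, A_j^T, B_g, and B_h^T … correspond to edges in the Cayley graph" (arXiv:2308.07915 chunk p0011 L34–36)] -/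
theorem adj_layoutMap_add_one_fst (c : ZMod (2 * addOrderOf (s - s'))) (d : ZMod (2 * addOrderOf (t - t'))) :
    (css a b).tannerGraph.Adj (layoutMap s s' t t' (c, d)) (layoutMap s s' t t' (c + 1, d)) := by
  haveI : NeZero (addOrderOf (s - s')) := ⟨(addOrderOf_pos _).ne'⟩
  set g := torusHom (s - s') (t - t') (half c, half d) with hg
  cases hc : par c
  · obtain ⟨h1, h2⟩ := half_par_add_one_of_even c hc
    cases hd : par d <;> simp [layoutMap, hc, hd, h1, h2, layoutVertex, hs]
  · obtain ⟨h1, h2⟩ := half_par_add_one_of_odd c hc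
    have hstep : torusHom (s - s') (t - t') (half c + 1, half d) = g + (s - s') :=
      torusHom_add_one_fst _ _ _ _
    cases hd : par d
    · simp only [layoutMap, hc, hd, h1, h2, layoutVertex, hstep, ← hg, adj_vX_vL]
      convert hs' using 2; abel
    · simp only [layoutMap, hc, hd, h1, h2, layoutVertex, hstep, ← hg, adj_vR_vZ]
      convert hs' using 2; abel

omit hs hs' in
/-- Vertical torus edges `(c,d) — (c,d+1)` go to Tanner-graph edges (edges "`B_g`", "`B_hᵀ`").
[cite: BravyiEtAl2024, proof of Lemma 4 (arXiv:2308.07915 chunk p0011 L34–36)] -/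
theorem adj_layoutMap_add_one_snd (c : ZMod (2 * addOrderOf (s - s'))) (d : ZMod (2 * addOrderOf (t - t'))) :
    (css a b).tannerGraph.Adj (layoutMap s s' t t' (c, d)) (layoutMap s s' t t' (c, d + 1)) := by
  haveI : NeZero (addOrderOf (t - t')) := ⟨(addOrderOf_pos _).ne'⟩
  set g := torusHom (s - s') (t - t') (half c, half d) with hg
  cases hd : par d
  · obtain ⟨h1, h2⟩ := half_par_add_one_of_even d hd
    cases hc : par c <;> simp [layoutMap, hc, hd, h1, h2, layoutVertex, ht']
  · obtain ⟨h1, h2⟩ := half_par_add_one_of_odd d hd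
    have hstep : torusHom (s - s') (t - t') (half c, half d + 1) = g + (t - t') :=
      torusHom_add_one_snd _ _ _ _
    cases hc : par c
    · simp only [layoutMap, hc, hd, h1, h2, layoutVertex, hstep, ← hg, adj_vZ_vL]
      convert ht using 2; abel
    · simp only [layoutMap, hc, hd, h1, h2, layoutVertex, hstep, ← hg, adj_vR_vX]
      convert ht using 2; abel

omit hs hs' ht ht' in
/-- The layout map is a bijection `ℤ_{2μ} × ℤ_{2ν} → vertices` under (i) and (ii).
[cite: BravyiEtAl2024, proof of Lemma 4 "this choice of (a,b) is unique" (arXiv:2308.07915 chunk p0011 L31–34)] -/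
theorem layoutMap_bijective (hgen : AddSubgroup.closure ({s - s', t - t'} : Set G) = ⊤)
    (hord : addOrderOf (s - s') * addOrderOf (t - t') = Fintype.card G) :
    Function.Bijective (layoutMap s s' t t') := by
  haveI : NeZero (addOrderOf (s - s')) := ⟨(addOrderOf_pos _).ne'⟩
  haveI : NeZero (addOrderOf (t - t')) := ⟨(addOrderOf_pos _).ne'⟩
  haveI : NeZero (2 * addOrderOf (s - s')) := ⟨by have := addOrderOf_pos (s - s'); omega⟩
  haveI : NeZero (2 * addOrderOf (t - t')) := ⟨by have := addOrderOf_pos (t - t'); omega⟩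
  have hinj := (torusHom_bijective (s - s') (t - t') hgen hord).1
  rw [Fintype.bijective_iff_injective_and_card]
  refine ⟨?_, ?_⟩
  · rintro ⟨c, d⟩ ⟨c', d'⟩ h
    obtain ⟨h1, h2, h3⟩ := layoutVertex_injective s t' h
    obtain ⟨h4, h5⟩ := Prod.mk.inj (hinj h3)
    exact Prod.ext (eq_of_half_eq_of_par_eq h4 h1) (eq_of_half_eq_of_par_eq h5 h2)
  · have h4 : 2 * addOrderOf (s - s') * (2 * addOrderOf (t - t')) = 4 * Fintype.card G := by
      rw [← hord]; ring
    simp only [Fintype.card_prod, Fintype.card_sum, ZMod.card, h4]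
    omega

/-- **Lemma 4 (with the printed parameters)**: if `α = s − s'` (`s, s' ∈ supp a`) and `β = t − t'`
(`t, t' ∈ supp b`) generate `G` and `ord α · ord β = |G|`, the Tanner graph of `css a b` has a toric
layout on `ℤ_{2 ord α} × ℤ_{2 ord β}`.
[cite: BravyiEtAl2024, Lemma 4 "A code QC(A,B) has a toric layout if there exist i,j,g,h … ⟨A_iA_j^T, B_gB_h^T⟩ = M and ord(A_iA_j^T) ord(B_gB_h^T) = ℓm" with μ = ord(A_iA_j^T), λ = ord(B_gB_h^T) (arXiv:2308.07915 chunk p0011 L28–36)] -/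
theorem hasToricLayoutWith_of_generators (hgen : AddSubgroup.closure ({s - s', t - t'} : Set G) = ⊤)
    (hord : addOrderOf (s - s') * addOrderOf (t - t') = Fintype.card G) :
    HasToricLayoutWith (addOrderOf (s - s')) (addOrderOf (t - t')) (css a b).tannerGraph := by
  refine ⟨layoutMap s s' t t', layoutMap_bijective hgen hord, ?_⟩
  rintro ⟨c, d⟩ ⟨c', d'⟩ h
  rcases torusGraph_adj_cases h with (h1 | h1) | (h1 | h1)
  · obtain ⟨rfl, rfl⟩ := Prod.mk.inj h1
    simpa using adj_layoutMap_add_one_fst hs hs' c d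
  · obtain ⟨rfl, rfl⟩ := Prod.mk.inj h1
    simpa using (adj_layoutMap_add_one_fst hs hs' c' d').symm
  · obtain ⟨rfl, rfl⟩ := Prod.mk.inj h1
    simpa using adj_layoutMap_add_one_snd ht ht' c d
  · obtain ⟨rfl, rfl⟩ := Prod.mk.inj h1
    simpa using (adj_layoutMap_add_one_snd ht ht' c' d').symm

/-- **Lemma 4**: under (i) and (ii) the two-block code has a toric layout.
[cite: BravyiEtAl2024, Lemma 4 (arXiv:2308.07915 chunk p0011 L28–30)] -/
theorem hasToricLayout_of_generators (hgen : AddSubgroup.closure ({s - s', t - t'} : Set G) = ⊤)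
    (hord : addOrderOf (s - s') * addOrderOf (t - t') = Fintype.card G) :
    HasToricLayout (css a b).tannerGraph :=
  ⟨addOrderOf (s - s'), addOrderOf (t - t'), addOrderOf_pos _, addOrderOf_pos _,
    hasToricLayoutWith_of_generators hs hs' ht ht' hgen hord⟩

end Layout

end AbelianTwoBlock

/-! ### Bivariate-bicycle phrasing -/

namespace BB.Code

variable {ℓ m : ℕ} [NeZero ℓ] [NeZero m] (C : Code ℓ m)

/-- **Lemma 4 for `QC(A,B)`** with exponents: if `g, g'` are exponents of `A` and `h, h'` exponents of
`B` such that `g − g'` and `h − h'` generate `ℤ_ℓ × ℤ_m` and `ord(g − g') · ord(h − h') = ℓm`, then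
`QC(A,B)` has a toric layout on `ℤ_{2 ord(g−g')} × ℤ_{2 ord(h−h')}` ("toric layout with `μ = m` and
`λ = ℓ`" for the codes of Table 3, where `g − g' = ∓y`, `h − h' = ∓x`).
[cite: BravyiEtAl2024, Lemma 4 and "All codes in Table have a toric layout with μ = m and λ = ℓ" (arXiv:2308.07915 chunk p0011 L28–39)] -/
theorem hasToricLayoutWith_of_exponents {g g' h h' : Mono ℓ m} (hg : C.A g ≠ 0) (hg' : C.A g' ≠ 0)
    (hh : C.B h ≠ 0) (hh' : C.B h' ≠ 0)
    (hgen : AddSubgroup.closure ({g - g', h - h'} : Set (Mono ℓ m)) = ⊤)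
    (hord : addOrderOf (g - g') * addOrderOf (h - h') = ℓ * m) :
    HasToricLayoutWith (addOrderOf (g - g')) (addOrderOf (h - h')) C.css.tannerGraph := by
  have e1 : (-g') - (-g) = g - g' := by abel
  have e2 : (-h') - (-h) = h - h' := by abel
  have key := AbelianTwoBlock.hasToricLayoutWith_of_generators (a := coeffVec C.A) (b := coeffVec C.B)
    (s := -g') (s' := -g) (t := -h') (t' := -h) (by simpa using hg') (by simpa using hg)
    (by simpa using hh') (by simpa using hh) (by rw [e1, e2]; exact hgen)
    (by rw [e1, e2, hord]; simp [Fintype.card_prod])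
  rw [e1, e2] at key
  exact key

/-- **Lemma 4 for `QC(A,B)`**, existential form. [cite: BravyiEtAl2024, Lemma 4 (arXiv:2308.07915 chunk p0011 L28–30)] -/
theorem hasToricLayout_of_exponents {g g' h h' : Mono ℓ m} (hg : C.A g ≠ 0) (hg' : C.A g' ≠ 0)
    (hh : C.B h ≠ 0) (hh' : C.B h' ≠ 0)
    (hgen : AddSubgroup.closure ({g - g', h - h'} : Set (Mono ℓ m)) = ⊤)
    (hord : addOrderOf (g - g') * addOrderOf (h - h') = ℓ * m) :
    HasToricLayout C.css.tannerGraph :=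
  ⟨addOrderOf (g - g'), addOrderOf (h - h'), addOrderOf_pos _, addOrderOf_pos _,
    C.hasToricLayoutWith_of_exponents hg hg' hh hh' hgen hord⟩

end BB.Code

end Literature.InformationTheory.QuantumCodes
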